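import Summits.BirchSwinnertonDyer.BirchSwinnertonDyer.Theorems.CMKolyvaginAtInertTwoGenusTrivialitySelmerAtTwo
import Summits.BirchSwinnertonDyer.BirchSwinnertonDyer.Theorems.GenusKolyvaginAtTwoPowDvdShaCardAtTwoRTRungDescentVariants
import Summits.BirchSwinnertonDyer.BirchSwinnertonDyer.Theorems.GenusKolyvaginAtTwoEquivariantKolyvaginExactAtTwoTwistLocalConditions
import Summits.BirchSwinnertonDyer.BirchSwinnertonDyer.Theorems.GenusKolyvaginAtTwoPowDvdShaCardAtTwoRTLadderFrame
import Literature.NumberTheory.EllipticCurves.LocalRestrictionDegree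
import Literature.NumberTheory.Automorphic.BCDTQuadraticTwistCharacters
import HarnessLib

/-!
# Route `CMKolyvaginAtInertTwo`, crux `CMKolyvaginExactAtInertTwo` (stmt-BirchSwinnertonDyer-24277) —
# Ш-VALUED DESCENT OF DOUBLED EIGENCLASSES (both signs): the Dokchitser–Dokchitser degree trick at the rung level

Seat `bsd-line-cmk2-p1` g20 (cell `bsd-print-cf2`), `--supports stmt-BirchSwinnertonDyer-24277` (helper;
closes nothing).  THEOREMS ONLY (no definition, no named fact, no `sorry`).  BSD is NOT proved by this.

Step (a) of the threading of memo `MEMO-genus-triviality.md` §6.2: gk2-p2's descent lemmas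
`exists_galH1Family_of_conjAct_eq` (fixed side) and `exists_galH1Family_twist_of_conjAct_eq_neg_of_injective`
(anti-fixed side) produce the ℚ-families of McCallum's ladders with restrictions in `Ш(·_K)`; here the SAME
families are produced together with the membership **`x_i ∈ Ш(W/ℚ)`**, **`x'_i ∈ Ш(W^{(d_K)}/ℚ)`**, under the
extra hypothesis that each `z_i` is a DOUBLE `2·z'_i` of an eigenclass `z'_i` that is Selmer at the places of
`K` over `d_K` (true for the (KS) classes `2^{L−M′}c_L(n)` with one spare level, `z' = 2^{L−M′−1}c_L(n)`,
Gross 6.2 (1) at `𝔮 ∤ n`): at `q ∣ d_K` the descended class of `z_i` is twice that of `z'_i`, and a class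
dying over `K_𝔮` dies over `ℚ_q` after doubling (`two_nsmul_mem_localRestrictionKer_of_tower`,
`[K_𝔮 : ℚ_q] ≤ 2`); off `d_K` by (desc-fin) (unramified good places / split bad places, for the twist via
`dvd_conductorNorm_quadraticTwist_iff_of_one_mod_four`); at `∞` by `Δ < 0`.

* §0 `two_nsmul_mem_selmerLocalKer_of_resTorsion_mem` / `_of_forall_under` (same level, per place: D–D),
  `hdescfin_twist_of_not_dvd_discr` ((desc-fin) for the twist off `d_K`).
* §1 `mem_selmerGroup_of_double`, `torsionH1ToH1_mem_sha_of_double` (a double with the right local data is Selmer over `ℚ`).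
* §2 `torsionH1ToH1_mem_sha_of_resTorsion_eq_double` (fixed side: the descent of `z = 2z'` lies in `Ш(X/ℚ)`),
  `torsionH1ToH1_twist_mem_sha_of_hPsiKT_resTorsion_eq_double` (anti-fixed side: in `Ш(X^{(c)}/ℚ)`).
The rung lemmas built on these are in the companion file `CMKolyvaginAtInertTwoGenusDefectShaRungsAtTwo`.

References: [DokchitserDokchitserAnnals2010] Lemma 4.14 (proof); [GrossLMS1991] §5 (5.1), Prop. 6.2 (1);
[McCallumLMS1991] §5 Prop. 5.2; [SerreGaloisCohomology1997] I.§2.4.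
-/

set_option autoImplicit false
-- the Theorems namespace of this sub repeats the summit name by design (D-0017 nested layout)
set_option linter.dupNamespace false

noncomputable section

open scoped Classical

namespace Summit.BirchSwinnertonDyer.BirchSwinnertonDyer.Theorems.KolyvaginGenusTwo

open WeierstrassCurve NumberField IsDedekindDomain Field Rat.HeightOneSpectrum
open Literature.NumberTheory.EllipticCurves Literature.NumberTheory.GaloisRepresentations
open Literature.NumberTheory.QuadraticFields
open Summit.BirchSwinnertonDyer.BirchSwinnertonDyer.Theorems.GenusExact
open Summit.BirchSwinnertonDyer.BirchSwinnertonDyer.Theorems.GenusExact.PlusDescent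
open Summit.BirchSwinnertonDyer.Rank1Residual.P2

variable {K : Type} [Field K] [NumberField K]

/-! ## §0 Doubling kills the genus component (per place, same level); (desc-fin) for the twist -/

/-- **Same level, one place** (`[L : K₀] ≤ 2`, `w ∣ v` finite): if `res_L ξ` is Selmer at `L_w` then `2ξ` is Selmer
at `(K₀)_v` (the class of `ξ` in `H¹((K₀)_v, E)` dies over `L_w`, hence twice it dies over `(K₀)_v`).
[cite: DokchitserDokchitserAnnals2010, Lemma 4.14 (proof)] [cite: SerreGaloisCohomology1997, I.§2.4 Cor. to Prop. 9] -/
theorem two_nsmul_mem_selmerLocalKer_of_resTorsion_mem {K₀ : Type} [Field K₀] [NumberField K₀]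
    (X : WeierstrassCurve K₀) [X.IsElliptic] (L : Type) [Field L] [NumberField L] [Algebra K₀ L]
    (h2 : Module.finrank K₀ L ≤ 2) {n : ℤ} (v : HeightOneSpectrum (𝓞 K₀)) (w : HeightOneSpectrum (𝓞 L))
    [w.asIdeal.LiesOver v.asIdeal] {ξ : galH1Torsion X n}
    (hξ : resTorsion X L n ξ ∈ selmerLocalKer (X.baseChange L) (w.adicCompletion L) n) :
    2 • ξ ∈ selmerLocalKer X (v.adicCompletion K₀) n := by
  obtain ⟨hfin, hle⟩ := finrank_adicCompletion_le_of_liesOver L v w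
  letI : Algebra (v.adicCompletion K₀) (w.adicCompletion L) := (adicCompletionMap (K := K₀) L v w).toAlgebra
  haveI : IsScalarTower K₀ (v.adicCompletion K₀) (w.adicCompletion L) :=
    IsScalarTower.of_algebraMap_eq fun x ↦ (adicCompletionMap_coe (K := K₀) L v w x).symm
  haveI : FiniteDimensional (v.adicCompletion K₀) (w.adicCompletion L) := hfin
  haveI : CharZero (v.adicCompletion K₀) :=
    charZero_of_injective_algebraMap (algebraMap K₀ (v.adicCompletion K₀)).injective
  rw [WeierstrassCurve.mem_selmerLocalKer_iff_torsionH1ToH1_mem, torsionH1ToH1_resTorsion] at hξ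
  have hx : torsionH1ToH1 X n ξ ∈ X.localRestrictionKer (w.adicCompletion L) :=
    (mem_localRestrictionKer_iff_resBaseChange_mem X _).mpr hξ
  rw [WeierstrassCurve.mem_selmerLocalKer_iff_torsionH1ToH1_mem, map_nsmul]
  exact two_nsmul_mem_localRestrictionKer_of_tower X (E := v.adicCompletion K₀) (hle.trans h2) hx

/-- `w ∣ v` form with `∀ w over v`: some `w ∣ v` exists. [cite: DokchitserDokchitserAnnals2010, Lemma 4.14 (proof)] -/
theorem two_nsmul_mem_selmerLocalKer_of_forall_under {K₀ : Type} [Field K₀] [NumberField K₀]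
    (X : WeierstrassCurve K₀) [X.IsElliptic] (L : Type) [Field L] [NumberField L] [Algebra K₀ L]
    (h2 : Module.finrank K₀ L ≤ 2) {n : ℤ} (v : HeightOneSpectrum (𝓞 K₀)) {ξ : galH1Torsion X n}
    (hξ : ∀ w : HeightOneSpectrum (𝓞 L), w.asIdeal.LiesOver v.asIdeal →
      resTorsion X L n ξ ∈ selmerLocalKer (X.baseChange L) (w.adicCompletion L) n) :
    2 • ξ ∈ selmerLocalKer X (v.adicCompletion K₀) n := by
  obtain ⟨w, hw⟩ := exists_liesOver L v
  haveI := hw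
  exact two_nsmul_mem_selmerLocalKer_of_resTorsion_mem X L h2 v w (hξ w hw)

/-- **(desc-fin) for the twist `W^{(d_K)}` off `d_K`**: at a finite `v` with `p_v ∤ d_K`, a class of
`H¹(ℚ, W^{(d_K)}[n])` whose restriction to `K` is Selmer at every `w ∣ v` is Selmer at `v` — the twist is
good at `v` unless `p_v ∣ N_W` (`d_K ≡ 1 (4)`, `dvd_conductorNorm_quadraticTwist_iff_of_one_mod_four`), and then
`v` splits (Heegner). [cite: MilneADT2006, Ch. I Prop. 3.8 and §6] [cite: SilvermanATAEC1994, IV.9.4] -/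
theorem hdescfin_twist_of_not_dvd_discr (W : WeierstrassCurve ℚ) [W.IsElliptic] (hK : IsImaginaryQuadratic K)
    (hodd : Odd (NumberField.discr K)) (hH : SatisfiesHeegnerHypothesis (W.conductorNorm ℤ) K)
    [(W.quadraticTwist (NumberField.discr K : ℚ)).IsElliptic] (m : ℤ)
    (ξ : galH1Torsion (W.quadraticTwist (NumberField.discr K : ℚ)) m)
    (v : HeightOneSpectrum (𝓞 ℚ)) (hnd : ¬ ((primesEquiv v : ℕ) : ℤ) ∣ NumberField.discr K)
    (hξ : ∀ w : HeightOneSpectrum (𝓞 K), w.under (𝓞 ℚ) = v →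
      resTorsion (W.quadraticTwist (NumberField.discr K : ℚ)) K m ξ ∈
        selmerLocalKer ((W.quadraticTwist (NumberField.discr K : ℚ)).baseChange K) (w.adicCompletion K) m) :
    ξ ∈ selmerLocalKer (W.quadraticTwist (NumberField.discr K : ℚ)) (v.adicCompletion ℚ) m := by
  have h2 : Module.finrank ℚ K = 2 := hK.1
  obtain ⟨θ, c, hθnot, hθ⟩ := Literature.NumberTheory.QuadraticFields.Quadratic.exists_sq_eq_algebraMap h2
  have hL := Literature.NumberTheory.QuadraticFields.Quadratic.exists_eq_add_mul h2 hθnot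
  haveI : Algebra.IsQuadraticExtension ℚ K := ⟨h2⟩
  haveI : IsGalois ℚ K := inferInstance
  haveI hpF : Fact (primesEquiv v : ℕ).Prime := ⟨(primesEquiv v).2⟩
  have hunr : Algebra.IsUnramifiedIn (𝓞 K) v.asIdeal := RationalDescentPlumbing.isUnramifiedIn_of_not_dvd_discr v hnd
  refine RationalDescentPlumbing.mem_selmerLocalKer_of_forall_under (W.quadraticTwist (NumberField.discr K : ℚ)) m v
    (fun w _ x hx ↦ ?_) hξ
  by_cases hgood : (W.quadraticTwist (NumberField.discr K : ℚ)).HasGoodReductionAt v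
  · exact mem_localRestrictionKer_adicCompletion_of_isUnramifiedIn _ K hθ hL hgood hunr w hx
  · have hdvd' : (primesEquiv v : ℕ) ∣ (W.quadraticTwist (NumberField.discr K : ℚ)).conductorNorm ℤ :=
      ((W.quadraticTwist (NumberField.discr K : ℚ)).dvd_conductorNorm_iff v).mpr hgood
    obtain ⟨k, hk⟩ := discr_eq_four_mul_add_one_of_odd h2 hodd
    have hd4 : NumberField.discr K % 4 = 1 := by omega
    have hdvd : (primesEquiv v : ℕ) ∣ W.conductorNorm ℤ :=
      (GenusGrossZagier.dvd_conductorNorm_quadraticTwist_iff_of_one_mod_four W hd4 hnd).mp hdvd'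
    have hsplit : (v.asIdeal.primesOver (𝓞 K)).ncard = Module.finrank ℚ K := by
      rw [← RationalDescentPlumbing.primesOver_span_eq_primesOver_asIdeal v rfl, hH _ (primesEquiv v).2 hdvd, h2]
    exact mem_localRestrictionKer_adicCompletion_of_ncard_primesOver_eq _ K hθ hL hsplit w hx

/-! ## §1 Doubles of eigenclasses Selmer at `d_K` descend into `Sel(ℚ)` (hence `ι` of them into `Ш(X/ℚ)`) -/

/-- If `p_v ∣ d_K` and `w ∣ v` then `d_K ∈ w`. [cite: NeukirchANT1999, Ch. I §8] -/
theorem intCast_discr_mem_asIdeal_of_dvd (v : HeightOneSpectrum (𝓞 ℚ)) (hd : ((primesEquiv v : ℕ) : ℤ) ∣ NumberField.discr K)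
    (w : HeightOneSpectrum (𝓞 K)) (hw : w.under (𝓞 ℚ) = v) :
    ((NumberField.discr K : ℤ) : 𝓞 K) ∈ w.asIdeal := by
  obtain ⟨m, hm⟩ := hd
  have h1 : ((primesEquiv v : ℕ) : 𝓞 ℚ) ∈ (w.under (𝓞 ℚ)).asIdeal := hw ▸ Literature.NumberTheory.Automorphic.BCDT.natCast_primesEquiv_mem_asIdeal v
  rw [HeightOneSpectrum.under_asIdeal, Ideal.under_def, Ideal.mem_comap, map_natCast] at h1
  rw [hm, Int.cast_mul, Int.cast_natCast]
  exact Ideal.mul_mem_right _ _ h1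

/-- **A DOUBLE `ξ = 2ξ'` WITH `res_K ξ` SELMER AND `res_K ξ'` SELMER AT THE PLACES OVER `d_K` IS SELMER OVER `ℚ`** (`[K : ℚ] ≤ 2`,
real place(s) handled by `hinf`, the finite places off `d_K` by the descent hypothesis `hoff` — (desc-fin) of the curve at hand): at
`v ∣ d_K` the class of `ξ'` dies over `K_w`, so twice it dies over `ℚ_v` (Dokchitser–Dokchitser).  With
`selmerGroup_eq_comap_sha`: `ι ξ ∈ Ш(X/ℚ)`. [cite: DokchitserDokchitserAnnals2010, Lemma 4.14 (proof)] [cite: GrossLMS1991, §5 (5.1)] -/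
theorem mem_selmerGroup_of_double (X : WeierstrassCurve ℚ) [X.IsElliptic] (h2 : Module.finrank ℚ K ≤ 2) {n : ℤ}
    (hinf : ∀ v : InfinitePlace ℚ, selmerLocalKer X v.Completion n = ⊤)
    (hoff : ∀ (v : HeightOneSpectrum (𝓞 ℚ)) (ξ : galH1Torsion X n), ¬ ((primesEquiv v : ℕ) : ℤ) ∣ NumberField.discr K →
      (∀ w : HeightOneSpectrum (𝓞 K), w.under (𝓞 ℚ) = v →
        resTorsion X K n ξ ∈ selmerLocalKer (X.baseChange K) (w.adicCompletion K) n) →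
      ξ ∈ selmerLocalKer X (v.adicCompletion ℚ) n)
    {ξ ξ' : galH1Torsion X n} (hξ : ξ = 2 • ξ')
    (hsel : resTorsion X K n ξ ∈ selmerGroup (X.baseChange K) n)
    (hsel' : ∀ w : HeightOneSpectrum (𝓞 K), ((NumberField.discr K : ℤ) : 𝓞 K) ∈ w.asIdeal →
      resTorsion X K n ξ' ∈ selmerLocalKer (X.baseChange K) (w.adicCompletion K) n) :
    ξ ∈ selmerGroup X n := by
  rw [mem_selmerGroup_iff] at hsel ⊢
  refine ⟨fun v ↦ ?_, fun v ↦ by rw [hinf]; trivial⟩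
  by_cases hd : ((primesEquiv v : ℕ) : ℤ) ∣ NumberField.discr K
  · rw [hξ]
    refine two_nsmul_mem_selmerLocalKer_of_forall_under X K h2 v fun w hw ↦ hsel' w ?_
    haveI := hw
    exact intCast_discr_mem_asIdeal_of_dvd v hd w (HeightOneSpectrum.ext (by rw [HeightOneSpectrum.under_asIdeal]; exact hw.over.symm))
  · exact hoff v ξ hd fun w _ ↦ hsel.1 w

/-- `ι`-form: under the hypotheses of `mem_selmerGroup_of_double`, `ι ξ ∈ Ш(X/ℚ)`. [cite: DokchitserDokchitserAnnals2010, Lemma 4.14 (proof)] -/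
theorem torsionH1ToH1_mem_sha_of_double (X : WeierstrassCurve ℚ) [X.IsElliptic] (h2 : Module.finrank ℚ K ≤ 2) {n : ℤ}
    (hinf : ∀ v : InfinitePlace ℚ, selmerLocalKer X v.Completion n = ⊤)
    (hoff : ∀ (v : HeightOneSpectrum (𝓞 ℚ)) (ξ : galH1Torsion X n), ¬ ((primesEquiv v : ℕ) : ℤ) ∣ NumberField.discr K →
      (∀ w : HeightOneSpectrum (𝓞 K), w.under (𝓞 ℚ) = v →
        resTorsion X K n ξ ∈ selmerLocalKer (X.baseChange K) (w.adicCompletion K) n) →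
      ξ ∈ selmerLocalKer X (v.adicCompletion ℚ) n)
    {ξ ξ' : galH1Torsion X n} (hξ : ξ = 2 • ξ')
    (hsel : resTorsion X K n ξ ∈ selmerGroup (X.baseChange K) n)
    (hsel' : ∀ w : HeightOneSpectrum (𝓞 K), ((NumberField.discr K : ℤ) : 𝓞 K) ∈ w.asIdeal →
      resTorsion X K n ξ' ∈ selmerLocalKer (X.baseChange K) (w.adicCompletion K) n) :
    torsionH1ToH1 X n ξ ∈ X.sha := by
  have h := mem_selmerGroup_of_double X h2 hinf hoff hξ hsel hsel'
  rw [selmerGroup_eq_comap_sha, AddSubgroup.mem_comap] at h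
  exact h

/-! ## §2 The descended double is in `Ш(X/ℚ)` (torsion level, fixed and anti-fixed) -/

section FixedSha

variable (X : WeierstrassCurve ℚ) [X.IsElliptic] (K : Type) [Field K] [NumberField K]
  (h2 : Module.finrank ℚ K = 2) {θ : K} {c : ℚ} (hθ : θ ∉ Set.range (algebraMap ℚ K))
  (hc : θ ^ 2 = algebraMap ℚ K c) (n : ℤ)

/-- **Fixed side.** `X(K)[n] = 0`; `xt ∈ H¹(ℚ, X[n])` the descent of a Selmer class `z = 2z'`, `z'` FIXED and Selmer at the
places over `d_K`: then `ι xt ∈ Ш(X/ℚ)` (the descent `xt'` of `z'` has `xt = 2xt'` by uniqueness, then `torsionH1ToH1_mem_sha_of_double`).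
[cite: DokchitserDokchitserAnnals2010, Lemma 4.14 (proof)] [cite: GrossLMS1991, §5 (5.1)] -/
theorem torsionH1ToH1_mem_sha_of_resTorsion_eq_double
    (hL : ∀ P : (X.baseChange K).toAffine.Point, n • P = 0 → P = 0)
    (hinf : ∀ v : InfinitePlace ℚ, selmerLocalKer X v.Completion n = ⊤)
    (hoff : ∀ (v : HeightOneSpectrum (𝓞 ℚ)) (ξ : galH1Torsion X n), ¬ ((primesEquiv v : ℕ) : ℤ) ∣ NumberField.discr K →
      (∀ w : HeightOneSpectrum (𝓞 K), w.under (𝓞 ℚ) = v →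
        resTorsion X K n ξ ∈ selmerLocalKer (X.baseChange K) (w.adicCompletion K) n) →
      ξ ∈ selmerLocalKer X (v.adicCompletion ℚ) n)
    {xt : galH1Torsion X n} {z z' : galH1Torsion (X.baseChange K) n} (hxt : resTorsion X K n xt = z)
    (hsel : z ∈ selmerGroup (X.baseChange K) n) (hz : z = 2 • z') (hfix' : conjAct X (sigmaQ K h2 hθ hc) n z' = z')
    (hsel' : ∀ w : HeightOneSpectrum (𝓞 K), ((NumberField.discr K : ℤ) : 𝓞 K) ∈ w.asIdeal →
      z' ∈ selmerLocalKer (X.baseChange K) (w.adicCompletion K) n) :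
    torsionH1ToH1 X n xt ∈ X.sha := by
  obtain ⟨xt', hxt', -⟩ := EigenClassesFinite.existsUnique_resTorsion_eq_of_conjAct_eq X K h2 hθ hc n hL hfix'
  have hdbl : xt = 2 • xt' :=
    EigenClassesFinite.resTorsion_injective_of_noTorsion X K h2 hθ hc n hL (by rw [map_nsmul, hxt', hxt, hz])
  exact torsionH1ToH1_mem_sha_of_double X h2.le hinf hoff hdbl (by rw [hxt]; exact hsel) fun w hw ↦ by
    rw [hxt']; exact hsel' w hw

omit [X.IsElliptic] in
/-- **Anti-fixed side.** `X(K)[n] = 0`; `xt ∈ H¹(ℚ, X^{(c)}[n])` the descent (through `hPsiKT`) of a Selmer class `z = 2z'` of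
`X_K`, `z'` ANTI-FIXED and Selmer at the places over `d_K`: then `ι xt ∈ Ш(X^{(c)}/ℚ)` (uniqueness + `hPsiKT` respects the Selmer
local conditions). [cite: DokchitserDokchitserAnnals2010, Lemma 4.14 (proof)] [cite: GrossLMS1991, §5 (5.1)] [cite: SilvermanAEC2009, X.5 Cor. 5.4] -/
theorem torsionH1ToH1_twist_mem_sha_of_hPsiKT_resTorsion_eq_double [(X.quadraticTwist c).IsElliptic]
    (hL : ∀ P : (X.baseChange K).toAffine.Point, n • P = 0 → P = 0)
    (hinf : ∀ v : InfinitePlace ℚ, selmerLocalKer (X.quadraticTwist c) v.Completion n = ⊤)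
    (hoff : ∀ (v : HeightOneSpectrum (𝓞 ℚ)) (ξ : galH1Torsion (X.quadraticTwist c) n),
      ¬ ((primesEquiv v : ℕ) : ℤ) ∣ NumberField.discr K →
      (∀ w : HeightOneSpectrum (𝓞 K), w.under (𝓞 ℚ) = v →
        resTorsion (X.quadraticTwist c) K n ξ ∈ selmerLocalKer ((X.quadraticTwist c).baseChange K) (w.adicCompletion K) n) →
      ξ ∈ selmerLocalKer (X.quadraticTwist c) (v.adicCompletion ℚ) n)
    {xt : galH1Torsion (X.quadraticTwist c) n} {z z' : galH1Torsion (X.baseChange K) n}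
    (hxt : hPsiKT X K hθ hc n (resTorsion (X.quadraticTwist c) K n xt) = z)
    (hsel : z ∈ selmerGroup (X.baseChange K) n) (hz : z = 2 • z') (hanti' : conjAct X (sigmaQ K h2 hθ hc) n z' = -z')
    (hsel' : ∀ w : HeightOneSpectrum (𝓞 K), ((NumberField.discr K : ℤ) : 𝓞 K) ∈ w.asIdeal →
      z' ∈ selmerLocalKer (X.baseChange K) (w.adicCompletion K) n) :
    torsionH1ToH1 (X.quadraticTwist c) n xt ∈ (X.quadraticTwist c).sha := by
  obtain ⟨xt', hxt', -⟩ := EigenClassesFinite.existsUnique_hPsiKT_resTorsion_eq_of_conjAct_eq_neg X K h2 hθ hc n hL hanti'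
  have hdbl : xt = 2 • xt' := EigenClassesFinite.resTorsion_twist_injective_of_noTorsion X K h2 hθ hc n hL
    ((hPsiKT X K hθ hc n).injective (by rw [map_nsmul, map_nsmul, hxt', hxt, hz]))
  refine torsionH1ToH1_mem_sha_of_double (X.quadraticTwist c) h2.le hinf hoff hdbl ?_ fun w hw ↦ ?_
  · rw [mem_selmerGroup_iff_hPsiKT_mem X K hθ hc n, hxt]
    exact hsel
  · rw [EigenClassesFinite.mem_selmerLocalKer_iff_hPsiKT_mem X K hθ hc n, hxt']
    exact hsel' w hw

end FixedSha

end Summit.BirchSwinnertonDyer.BirchSwinnertonDyer.Theorems.KolyvaginGenusTwo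

end
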